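/- Copyright: the b2b-balaban cell (near-miss cell 7), T⁴-continuum fan-out; row NE7b CRUX team (2), seat
t4-ne7b-formalise-leaf-05 (gen 31) — item (C) of the row OWNER's INTERFACE REQUEST NE7b IR-46-1, second step
(«one-term reading on which `upM_of_reading` ∕ `priceM_of_reading` instantiate BY NAME», HOME/INBOX.md l.8971 (C);
`CLAIMS.log` l.31751 ∕ l.31788).  Released under the licence of the surrounding project. -/
import Summits.QuantumFields.BalabanUV.T4Continuum.Support.HistoryRealiseCellsRunSupplyKeysWTVS
import Summits.QuantumFields.BalabanUV.T4Continuum.Support.HistoryRealiseCellsRunSupplyWTVSSanity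

/-!
# Sanity for the (α) supplier plug, second step: THE FOUR WITNESS FIELDS `upM` ∕ `FM_nonneg` ∕ `priceM` ∕ `resumM` AT THE
CREW'S LETTERS (`FcM := LIVEOf`, `RfM := MULTOf`) INSTANTIATE BY NAME ON ONE TOY READING WITH ONE SET OF SHARP LETTERS
(companion of `HistoryRealiseCellsRunSupplyKeysWTVS`; INTERFACE REQUEST NE7b IR-46-1 (C), lineage
`t4-ne7b-formalise-leaf-05` gen 31)

Summits-side support leaf of the T⁴-continuum cell (rung (B)+1 on a FINITE torus only; NOT infinite volume, NOT the
mass gap, NOT Clay; NOT a proof of NE7b — the cell's OWN estimate, NOT PRINTED, NOT PROVED).  [folklore] decided toy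
arithmetic; reuses BY NAME the first step's toy reading `ℛ₁` ∕ constants `C₂` (`HistoryRealiseCellsRunSupplyWTVSSanity`),
M1's skeleton `toy1` ∕ `Isk` ∕ `μ₀` (leaf-04), the owner's toy sharp letters WITH the fibre share `sBF` ∕ `sRF` and
`roundingRoomF_toy` (`HistoryBankingFibreRoom.Sanity`), `factorRead_exp` (`HistoryBankingCreditRead.Sanity`), the toy
printed record `O₁` (`HistoryConstants.Sanity`); nothing printed asserted, no `def … : Prop` fact, no cite-tagged
hypothesis, zero `sorry`.

THE POINT (joint inhabitation at ONE set of letters).  With leaf-04's unit factors `Φ₀` (`fB ≡ fR ≡ 1`) the factor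
reading `FactorRead 1 1 sB sR` forces `sB, sR ≤ 0`, incompatible with ANY rounding junction (`dshare > 0`): so the toy
factor data here EXPONENTIATE the owner's toy sharp letters — `Φ₂.fB K j d′ _ := e^{−sBF C₂ 1 (R ≡ 2) K O₁ g₁ φB₁ j d′}`,
`Φ₂.fR K h := e^{−sRF C₂ 1 (R ≡ 2) O₁ g₁ φR₁ h}`, `Λ ≡ 1`, envelopes `1`, `BA ≡ BV ≡ 0` — and then, at the SAME `(sB, sR, φB, φR)`:
`FactorRead (Φ₂.fB K) (Φ₂.fR K) (sB₂ K) sR₂` (`factorRead_toy`), `RoundingRoomF C₂ O₁ 1 K (ℛ₁.R K) g₁ (sB₂ K) sR₂ φB₁ φR₁`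
(`roundingRoomF_toy₂`), (2.9) `FlowIneq29 (ℛ₁.R K) g₁ 1 β′ 0 K` (`flow29_toy`), `HistRead ℛ₁ Φ₂ toy1 1 0` (`histRead_toy₂`),
the process conditions ∕ volume calibration of the first step, and cell-injectivity (vacuous: no live name) hold AT ONCE,
and the sibling's **`upM_of_reading'`**, **`FM_nonneg_of_reading`**, **`priceM_of_reading`**, **`resumM_of_reading`**
instantiate BY NAME (`upM'_toy`, `FM_nonneg_toy`, `priceM_toy`, `resumM'_toy`).  Their conclusions range over the bad
terms ∕ bad key classes — EMPTY on a reading without regions (first step's `badTerms_toy` ∕ `badGMems_toy`): the junction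
of IR-46-2's run-A supplier table is live and its hypothesis list consistent; content nil by design.  THE NON-VACUOUS
CHARGE (§3, abstract carriers): on the two-name bare-birth pedigree `P2` with distinct root cells, module B′'s
`priceM_of_keys_of_charge` holds BY NAME once the CHARGE is READ on the birth letter `b = (0,0,0)` —
`pcredit b + (8∕E₂·evCost 0 b + 4·0) + φ b ≤ σ b`, the birth clause of `RoundingRoomF` at that event (decided rewriting of
`credits` ∕ `totalCostT` ∕ `partnerAges` on a bare birth).

HONEST.  Proves nothing of Bałaban's; `FactorRead`, `RoundingRoomF`, (2.9), `HistRead`, the volume calibration, (ρ) stay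
R-class HYPOTHESES of the plug (here inhabited by TOY letters, not print's values — c2); BY-NAME EFFECT ON THE WALL:
NONE; NE7b NOT proved; spine 0∕9.  HONEST DEPENDENCY (cell): continuum YM on T⁴ ⇐ BetaPertH ∧ nine spine estimates (0/9
proved); BetaPertH ⇐ (D1) ∧ (D4) ∧ CAP+tail; G-an2-4 gates asym, D1 and NE2/3/4.  Unchanged here.
-/

open Finset MeasureTheory
open Literature.MathematicalPhysics.QuantumFieldTheory.Balaban1983to89
open Literature.MathematicalPhysics.QuantumFieldTheory.Balaban1983to89.B16SProfile (DropCtl)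
open T4PersistenceDictionary T4PrintedShapeBanking T4TaggedShapeBanking T4BankedInduction T4PartnerMultiplicity
open T4LiveClassFibration T4RenewalChains
open Summit.QuantumFields.BalabanUV.T4Continuum.HistoryAdmissible
open Summit.QuantumFields.BalabanUV.T4Continuum.HistoryGen
open Summit.QuantumFields.BalabanUV.T4Continuum.HistoryGenealogyExtraction
open Summit.QuantumFields.BalabanUV.T4Continuum.HistoryGenealogyRealise
open Summit.QuantumFields.BalabanUV.T4Continuum.HistoryGenealogyInstantiate
open Summit.QuantumFields.BalabanUV.T4Continuum.HistoryGenealogyPedigree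
open Summit.QuantumFields.BalabanUV.T4Continuum.HistoryAssemblyPedigree Summit.QuantumFields.BalabanUV.T4Continuum.HistoryAssemblyTerms
open Summit.QuantumFields.BalabanUV.T4Continuum.HistoryAssemblyMult Summit.QuantumFields.BalabanUV.T4Continuum.HistoryAssemblyMultKey
open Summit.QuantumFields.BalabanUV.T4Continuum.B16HistoryIndexedRepr
open Summit.QuantumFields.BalabanUV.T4Continuum.HistoryBankingLE Summit.QuantumFields.BalabanUV.T4Continuum.HistoryBankingVolumePlug
open Summit.QuantumFields.BalabanUV.T4Continuum.HistoryConstants Summit.QuantumFields.BalabanUV.T4Continuum.HistoryBankingDiscountCharge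
open Summit.QuantumFields.BalabanUV.T4Continuum.HistoryBankingCreditRead Summit.QuantumFields.BalabanUV.T4Continuum.HistoryBankingFibreRoom
open Summit.QuantumFields.BalabanUV.T4Continuum.HistoryPriceNodeSum Summit.QuantumFields.BalabanUV.T4Continuum.HistoryPriceKeys
open Summit.QuantumFields.BalabanUV.T4Continuum.HistoryRealiseCellsRunSupplyWTVS
open Summit.QuantumFields.BalabanUV.T4Continuum.HistoryRealiseCellsRunSupplyKeysWTVS
open Summit.QuantumFields.BalabanUV.T4Continuum.HistoryRealiseCellsRunSupplyWTVSSanity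

namespace Summit.QuantumFields.BalabanUV.T4Continuum.HistoryRealiseCellsRunSupplyKeysWTVSSanity

noncomputable section

open B16HistoryIndexedRepr.Sanity B16HistoryIndexedRepr.SanityInput HistoryConstants.Sanity HistoryBankingCreditRead.Sanity
open HistoryBankingFibreRoom.Sanity

-- the structural `DecidableEq` instance of the concrete tag type exceeds the default synthesis size (as in the siblings)
set_option synthInstance.maxSize 1024

/-! ## (S4) One set of toy letters: coupling profile, fibre shares, sharp letters WITH the share, exponentiated factors -/

/-- a toy coupling profile (any real would do) [folklore] -/
def g₁ : ℕ → ℝ := fun _ => 1 / 2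
/-- toy fibre shares: one unit per birth, one per renewal (TOY symbols) [folklore] -/
def φB₁ : ℕ → ℕ → ℝ := fun _ _ => 1
/-- toy fibre shares, renewals [folklore] -/
def φR₁ : ℕ → ℝ := fun _ => 1
/-- the toy sharp birth letters WITH the share: the owner's `sBF` at `C₂`, flow `L = 1`, `R ≡ 2`, `O₁`, `g₁`, `φB₁` [folklore] -/
def sB₂ (K : ℕ) : ℕ → ℕ → ℝ := sBF C₂ 1 (fun _ => 2) K O₁ g₁ φB₁
/-- the toy sharp renewal letters WITH the share [folklore] -/
def sR₂ : ℕ → ℝ := sRF C₂ 1 (fun _ => 2) O₁ g₁ φR₁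

/-- **TOY FACTOR DATA WITH THE SHARP LETTERS EXPONENTIATED**: `fB := e^{−sB₂}`, `fR := e^{−sR₂}`, unit per-cube cost and
envelopes, zero upper envelopes. [folklore] -/
def Φ₂ : HistFactors Isk 1 where
  fB K j d _ := Real.exp (-sB₂ K j d)
  fR _ h := Real.exp (-sR₂ h)
  Λ _ _ := 1
  one_le_Λ _ _ := le_rfl
  wZ _ _ _ _ := 1
  wY _ _ _ _ := 1
  wC _ _ _ _ := 1
  BA _ _ := 0
  BV _ _ _ _ _ _ := 0

/-- **THE FACTOR READING HOLDS** at the letters `(sB₂ K, sR₂)` — with equality. [folklore] -/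
theorem factorRead_toy (K : ℕ) : FactorRead (Φ₂.fB K) (Φ₂.fR K) (sB₂ K) sR₂ := factorRead_exp _ _

/-- **THE ROUNDING JUNCTION WITH THE FIBRE SHARE HOLDS** at the SAME letters (the owner's `roundingRoomF_toy`). [folklore] -/
theorem roundingRoomF_toy₂ (K : ℕ) : RoundingRoomF C₂ O₁ 1 K (ℛ₁.R K) g₁ (sB₂ K) sR₂ φB₁ φR₁ :=
  roundingRoomF_toy C₂ (by norm_num [C₂]) (le_of_eq rfl) 1 K (fun _ => 2) O₁ g₁ φB₁ φR₁

/-- **(2.9) HOLDS** on the constant sizes `R ≡ 2` with flow blocking `1` and `β₀ = 0` (any `β′`, any cutoff). [folklore] -/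
theorem flow29_toy (K : ℕ) (β' : ℝ) : B14FlowStep.FlowIneq29 (ℛ₁.R K) g₁ 1 β' 0 K := by
  intro m n _ _
  simp [ℛ₁]

/-- **`HistRead` HOLDS** for `Φ₂` on the toy reading (empty forest; envelopes attained). [folklore] -/
theorem histRead_toy₂ : HistRead ℛ₁ Φ₂ (fun _ _ => toy1) 1 0 where
  χ01 _ _ _ _ := ⟨zero_le_one, le_rfl⟩
  tz_le _ _ _ _ _ _ _ _ := le_of_eq rfl
  ty_le _ _ _ _ _ _ _ _ := le_of_eq rfl
  tc_le _ _ _ _ _ _ _ _ := le_of_eq rfl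
  A'_le _ _ _ _ _ := le_rfl
  Vs_le _ _ _ _ _ _ _ _ _ := le_rfl
  forest_le K t _ _ a ι _ := by
    show (1 : ℝ) * 1 ≤ _
    rw [Finset.prod_congr rfl fun j _ => by rw [compM_runOf_eq_empty K a ι j, Finset.prod_empty], Finset.prod_const_one]
    norm_num

/-- the volume calibration at `Λ ≡ 1` for `Φ₂` (as for `Φ₀`): doubling display [folklore] -/
theorem hLu_toy₂ (K j : ℕ) : ∀ t i, i ≤ j → Real.log (Φ₂.Λ K (t + i)) ≤ 1 * Real.log (Φ₂.Λ K t) := fun _ _ _ => by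
  simp [Φ₂]
/-- floor display [folklore] -/
theorem huΦ_toy₂ (K : ℕ) : ∀ t, t ≤ K →
    Real.log (Φ₂.Λ K t) * (6 * (561 ^ 1 * (20 : ℕ) * (1 : ℝ) + 1122 ^ 1 * 1)) ≤ floorK C₂ K (ℛ₁.R K) t := fun t _ => by
  have h0 : 0 ≤ floorK C₂ K (ℛ₁.R K) t := floorK_nonneg (C := C₂) (K := K) (R := ℛ₁.R K) (by norm_num [C₂]) t
  simpa [Φ₂] using h0
/-- `E₂` display [folklore] -/
theorem huE₂_toy₂ (K : ℕ) : ∀ n, n ≤ K → Real.log (Φ₂.Λ K n) * (15 * 126 ^ 1) ≤ C₂.E₂ * (ℛ₁.R K n : ℝ) ^ C₂.q' :=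
  fun _ _ => by simp [Φ₂, C₂, ℛ₁]
/-- `E₃` display [folklore] -/
theorem huE₃_toy₂ (K : ℕ) : ∀ n, n ≤ K → Real.log (Φ₂.Λ K n) * (24 * 126 ^ 1) ≤ C₂.E₃ * (ℛ₁.R K n : ℝ) ^ C₂.q' :=
  fun _ _ => by simp [Φ₂, C₂]

/-- cell-injectivity on the live names: vacuous (no live name) [folklore] -/
theorem hinj_toy {γ : Type*} (cellOf : ℕ → HIndex.Idx Isk → ℕ × Lab 1 → γ) (K : ℕ) :
    ∀ τ ∈ HIndex.termSet Isk K, Set.InjOn (cellOf K τ) (ℛ₁.inputOf.liveCV K τ : Set (ℕ × Lab 1)) := by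
  intro τ _ a ha
  have h : ℛ₁.inputOf.liveCV K τ = ∅ := by
    show ((ℛ₁.inputOf.run K τ).histV.comp K).image (Prod.mk K) = ∅
    rw [comp_run_eq_empty, Finset.image_empty]
  rw [h] at ha
  exact absurd ha (by simp)

/-! ## (S5) The four fields of the VS-witness at the crew's letters, BY NAME on the toy -/

/-- **`upM_of_reading'` ON THE TOY** (`FcM := LIVEOf` at `sharpT (sB₂ K) sR₂`, `W ≡ 2`; every binder discharged). [folklore] -/
theorem upM'_toy (K : ℕ) {t : ℝ} (ht : |t| ≤ 1) (jstar : ℕ → ℕ) :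
    ∀ k ∈ badGMems (memOf ℛ₁.inputOf.pedV ℛ₁.inputOf.liveCV (fun _ _ _ => (0 : ℕ))) jstar (HIndex.termSet Isk)
        (kmemOf ℛ₁.inputOf.pedV ℛ₁.inputOf.liveCV (fun _ _ _ => (0 : ℕ)) (fun _ _ _ => ())) K,
      ∀ τ ∈ fibre (kmemOf ℛ₁.inputOf.pedV ℛ₁.inputOf.liveCV (fun _ _ _ => (0 : ℕ)) (fun _ _ _ => ()))
          (HIndex.termSet Isk) K k,
        Repr172R.weight μ₀ (fun _ _ => toy1) t τ ≤
          deadOf ℛ₁ Φ₂ (fun _ => 2) K t τ *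
            LIVEOf C₂ K (ℛ₁.R K) (fun n => 2 ^ (1 + 3) * Real.log (Φ₂.Λ K n)) (sharpT (sB₂ K) sR₂) k *
            nupOf Φ₂ (fun K => (μ₀ K).real Set.univ) (fun _ => 2) K t :=
  upM_of_reading' ℛ₁ Φ₂ μ₀ (fun _ _ => toy1) histRead_toy₂ (Nat.zero_le K) (K := K) ht (fun τ _ => newOK_run K τ)
    (fun τ _ => rm_le_run K τ) (fun τ _ => rmS_run K τ) (fun τ _ => rm2_run K τ) (fun τ _ => newDisjoint_run K τ)
    (by norm_num [ℛ₁]) (le_of_eq rfl) (dropCtl_toy K) (fun _ => by norm_num [ℛ₁]) (C := C₂) (le_of_eq rfl)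
    (by norm_num [C₂]) (le_of_eq rfl) one_pos (j := 20) (by norm_num) (hLu_toy₂ K 20) hsmall_toy (huΦ_toy₂ K)
    (huE₂_toy₂ K) (huE₃_toy₂ K) (factorRead_toy K) (W := fun _ => 2) two_pos (fun _ _ _ => (0 : ℕ)) (fun _ _ _ => ())
    (hinj_toy (fun _ _ _ => (0 : ℕ)) K) jstar

/-- **`FM_nonneg_of_reading` ON THE TOY.** [folklore] -/
theorem FM_nonneg_toy (K : ℕ) (jstar : ℕ → ℕ) :
    ∀ k ∈ badGMems (memOf ℛ₁.inputOf.pedV ℛ₁.inputOf.liveCV (fun _ _ _ => (0 : ℕ))) jstar (HIndex.termSet Isk)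
        (kmemOf ℛ₁.inputOf.pedV ℛ₁.inputOf.liveCV (fun _ _ _ => (0 : ℕ)) (fun _ _ _ => ())) K,
      0 ≤ LIVEOf C₂ K (ℛ₁.R K) (fun n => 2 ^ (1 + 3) * Real.log (Φ₂.Λ K n)) (sharpT (sB₂ K) sR₂) k :=
  FM_nonneg_of_reading ℛ₁ C₂ K (ℛ₁.R K) _ _ (fun _ _ _ => (0 : ℕ)) (fun _ _ _ => ()) jstar

/-- **`priceM_of_reading` ON THE TOY** (`FcM := LIVEOf`, `RfM := MULTOf (sharpT φB₁ φR₁)`, the rounding junction WITH the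
fibre share and (2.9) at the SAME letters; the conclusion ranges over the bad terms — none here). [folklore] -/
theorem priceM_toy (K : ℕ) (jstar : ℕ → ℕ) :
    ∀ τ ∈ badTerms (memOf ℛ₁.inputOf.pedV ℛ₁.inputOf.liveCV (fun _ _ _ => (0 : ℕ))) jstar (HIndex.termSet Isk) K,
      LIVEOf C₂ K (ℛ₁.R K) (fun n => 2 ^ (1 + 3) * Real.log (Φ₂.Λ K n)) (sharpT (sB₂ K) sR₂)
            (kmemOf ℛ₁.inputOf.pedV ℛ₁.inputOf.liveCV (fun _ _ _ => (0 : ℕ)) (fun _ _ _ => ()) K τ) *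
          MULTOf (sharpT φB₁ φR₁) (kmemOf ℛ₁.inputOf.pedV ℛ₁.inputOf.liveCV (fun _ _ _ => (0 : ℕ)) (fun _ _ _ => ()) K τ) ≤
        ∏ q ∈ memOf ℛ₁.inputOf.pedV ℛ₁.inputOf.liveCV (fun _ _ _ => (0 : ℕ)) K τ,
          pshapeTH Prod.fst O₁ C₂ 1 1 (ℛ₁.R K) g₁ 0 (costT Prod.fst C₂ K (ℛ₁.R K)) q.2 *
            Real.exp (birthWT Prod.fst (fun n => 2 ^ (1 + 3) * Real.log (Φ₂.Λ K n)) q.2) *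
            Real.exp (-(8 / C₂.E₂ * totalCostT Prod.fst C₂ K (ℛ₁.R K) q.2 +
              4 * (partnerAges (PEv.step ∘ Prod.fst) q.2 : ℝ))) :=
  priceM_of_reading ℛ₁ Φ₂ (K := K) (fun τ _ => newOK_run K τ) (fun τ _ => rm_le_run K τ) (fun τ _ => rmS_run K τ)
    (fun τ _ => rm2_run K τ) (fun τ _ => newDisjoint_run K τ) (by norm_num [ℛ₁]) (le_of_eq rfl) (dropCtl_toy K)
    (fun _ => by norm_num [ℛ₁]) (C := C₂) (le_of_eq rfl) (by norm_num [C₂]) (le_of_eq rfl) (roundingRoomF_toy₂ K)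
    (flow29_toy K 0) le_rfl (fun _ _ _ => (0 : ℕ)) (fun _ _ _ => ()) (hinj_toy (fun _ _ _ => (0 : ℕ)) K) jstar

/-- **`resumM_of_reading` ON THE TOY** (`RfM := MULTOf (sharpT φB₁ φR₁)`, `W ≡ 2`; the display (ρ) is vacuous here — no bad
key class — and is supplied as such). [folklore] -/
theorem resumM'_toy (K : ℕ) (t : ℝ) (jstar : ℕ → ℕ) :
    ∀ k ∈ badGMems (memOf ℛ₁.inputOf.pedV ℛ₁.inputOf.liveCV (fun _ _ _ => (0 : ℕ))) jstar (HIndex.termSet Isk)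
        (kmemOf ℛ₁.inputOf.pedV ℛ₁.inputOf.liveCV (fun _ _ _ => (0 : ℕ)) (fun _ _ _ => ())) K,
      ∑ τ ∈ fibre (kmemOf ℛ₁.inputOf.pedV ℛ₁.inputOf.liveCV (fun _ _ _ => (0 : ℕ)) (fun _ _ _ => ()))
          (HIndex.termSet Isk) K k, deadOf ℛ₁ Φ₂ (fun _ => 2) K t τ ≤ MULTOf (sharpT φB₁ φR₁) k :=
  resumM_of_reading ℛ₁ Φ₂ (K := K) (W := fun _ => 2) two_pos t (fun _ _ _ => (0 : ℕ)) (fun _ _ _ => ()) jstar φB₁ φR₁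
    fun k hk => by
      rw [badGMems_toy] at hk
      exact absurd hk (Finset.notMem_empty k)

/-- the four fields hold SIMULTANEOUSLY at one cutoff, one source value, one set of letters [folklore] -/
example (K : ℕ) (jstar : ℕ → ℕ) :
    (∀ k ∈ badGMems (memOf ℛ₁.inputOf.pedV ℛ₁.inputOf.liveCV (fun _ _ _ => (0 : ℕ))) jstar (HIndex.termSet Isk)
        (kmemOf ℛ₁.inputOf.pedV ℛ₁.inputOf.liveCV (fun _ _ _ => (0 : ℕ)) (fun _ _ _ => ())) K,
      0 ≤ LIVEOf C₂ K (ℛ₁.R K) (fun n => 2 ^ (1 + 3) * Real.log (Φ₂.Λ K n)) (sharpT (sB₂ K) sR₂) k) ∧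
    (∀ k ∈ badGMems (memOf ℛ₁.inputOf.pedV ℛ₁.inputOf.liveCV (fun _ _ _ => (0 : ℕ))) jstar (HIndex.termSet Isk)
        (kmemOf ℛ₁.inputOf.pedV ℛ₁.inputOf.liveCV (fun _ _ _ => (0 : ℕ)) (fun _ _ _ => ())) K,
      ∑ τ ∈ fibre (kmemOf ℛ₁.inputOf.pedV ℛ₁.inputOf.liveCV (fun _ _ _ => (0 : ℕ)) (fun _ _ _ => ()))
          (HIndex.termSet Isk) K k, deadOf ℛ₁ Φ₂ (fun _ => 2) K 0 τ ≤ MULTOf (sharpT φB₁ φR₁) k) :=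
  ⟨FM_nonneg_toy K jstar, resumM'_toy K 0 jstar⟩

/-! ## (S6) THE NON-VACUOUS CHARGE: module B′'s `priceM_of_keys_of_charge` BY NAME on a two-name bare-birth pedigree,
with the charge READ on the birth letter -/

/-- two component names, each ONE fresh class-`0` region born at step `0` [folklore] -/
def P2 : Pedigree (Fin 2) Unit where
  step _ := 0
  parts _ := [Part.new 0 ()]
  step_lt c c' r h := by simp at h

/-- its tagged genealogies: bare births tagged by the name [folklore] -/
theorem genT_P2 (c : Fin 2) : P2.genT c = Gen.born ((((0, 0, 0) : PEv)), Tag.birth c 0 0 ()) 0 := by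
  rw [Pedigree.genT_eq]; rfl

/-- one term reading both names live, DISTINCT root cells (the name is the cell), trivial physical datum [folklore] -/
def pedI : ℕ → Unit → Pedigree (Fin 2) Unit := fun _ _ => P2
/-- live names [folklore] -/
def liveI : ℕ → Unit → Finset (Fin 2) := fun _ _ => Finset.univ
/-- root cells [folklore] -/
def cellI : ℕ → Unit → Fin 2 → Fin 2 := fun _ _ c => c
/-- physical data [folklore] -/
def physI : ℕ → Unit → Fin 2 → Unit := fun _ _ _ => ()

/-- distinct root cells [folklore] -/
theorem injOn_cellI (K : ℕ) : Set.InjOn (cellI K ()) (liveI K () : Set (Fin 2)) := fun _ _ _ _ h => h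
/-- bare births are well formed for any table [folklore] -/
theorem wf_P2 (K : ℕ) (c : Fin 2) (W' : Lab (Fin 2) Unit → ℕ) : ((pedI K ()).genT c).WF W' := by
  show (P2.genT c).WF W'
  rw [genT_P2]; trivial

/-- print's credits of a bare birth: the letter of its label [folklore] -/
theorem credits_born {ε : Type*} [DecidableEq ε] (f : ε → ℝ) (x : ε) (j : ℕ) : credits f (Gen.born x j) = f x := by
  simp [credits]
/-- the total booked cost of a bare birth: its event cost at its step [folklore] -/
theorem totalCostT_born {ε : Type*} [DecidableEq ε] (sh : ε → PEv) (C : T4PrintedShapeBanking.Consts) (K : ℕ)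
    (R : ℕ → ℕ) (x : ε) (j : ℕ) : totalCostT sh C K R (Gen.born x j) = evCost sh C K R j x := by
  simp [totalCostT]

/-- **`priceM_of_keys_of_charge` BY NAME, THE CHARGE READ ON THE BIRTH LETTER**: if, for each of the two names, the
booked credit, the own discount share and the fibre share of the birth `b = (0,0,0)` are together at most its sharp
letter — `pcredit O C g b + (8∕E₂·evCost 0 (b, tag) + 4·0) + φ b ≤ σ b`, the birth clause of `RoundingRoomF` at that
event — then the witness's `priceM` sentence holds on the term at `FcM := LIVEOf`, `RfM := MULTOf φ`. [folklore] -/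
theorem priceM_charge_toy (O : PrintedO1s) (C : T4PrintedShapeBanking.Consts) (K : ℕ) (R : ℕ → ℕ) (g u : ℕ → ℝ)
    (σ φ : PEv → ℝ)
    (hb : ∀ c : Fin 2, pcredit O C g ((0, 0, 0) : PEv) +
        (8 / C.E₂ * evCost Prod.fst C K R 0 ((((0, 0, 0) : PEv), Tag.birth c 0 0 ()) : Lab (Fin 2) Unit) +
          4 * ((0 : ℕ) : ℝ)) + φ (0, 0, 0) ≤ σ (0, 0, 0)) :
    LIVEOf C K R u σ (kmemOf pedI liveI cellI physI K ()) * MULTOf φ (kmemOf pedI liveI cellI physI K ()) ≤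
      ∏ q ∈ memOf pedI liveI cellI K (),
        pshapeTH Prod.fst O C 1 1 R g 0 (costT Prod.fst C K R) q.2 * Real.exp (birthWT Prod.fst u q.2) *
          Real.exp (-(8 / C.E₂ * totalCostT Prod.fst C K R q.2 + 4 * (partnerAges (PEv.step ∘ Prod.fst) q.2 : ℝ))) :=
  priceM_of_keys_of_charge (ped := pedI) (liveC := liveI) (cellOf := cellI) (phys := physI) (τ := ())
    (injOn_cellI K) (W' := fun _ => 3) (fun c _ => wf_P2 K c _) fun c _ => by
      rw [show (pedI K ()).genT c = P2.genT c from rfl, genT_P2, credits_born, credits_born, credits_born,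
        totalCostT_born]
      exact hb c

end

end Summit.QuantumFields.BalabanUV.T4Continuum.HistoryRealiseCellsRunSupplyKeysWTVSSanity
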